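import Summits.BirchSwinnertonDyer.Rank1Residual.X2.PrimeOrderCharacters
import Summits.BirchSwinnertonDyer.Rank1Residual.X2.ResidualDevissageLine
import Literature.NumberTheory.EllipticCurves.GoodReductionUnramifiedProofs
import Literature.NumberTheory.EllipticCurves.GaloisActionProofs
import HarnessLib

/-!
# Class X2 (odd multiplicative Eisenstein prime): the characters `φ` of `Φ₀` and `ψ` of `E[p]/Φ₀`
# as primitive Dirichlet characters — parity, ramification at `p`, primes of the conductors
# (cell `b2b-bsdres`, unit `b2b-bsdres-eisenstein-p2`, gen 21; part 2 of 3 of the UNFOLDING of the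
# reading-facts A196 / p253710, see `EisensteinCongruenceOfFacts.lean`)

HONEST FRAMING (run/shared/lean/b2b/bsd-rank1-residual/, verbatim in every file): the goal of the
cell is to DELETE the COMBINATION-SHAPED residual classes of the Birch–Swinnerton-Dyer formula for
ALL analytic-rank `≤ 1` elliptic curves over `ℚ` — "full BSD formula for every rank `≤ 1` curve in
class `C`" assembled STRICTLY from published theorems — so that the rank-`≤ 1` remainder becomes
exactly the CONSTRUCTION-SHAPED classes, which are TYPED (missing-input `Prop`s), NOT attempted.
This is not "finishing BSD". Research route; NO CLAIM BEYOND STATED CLASSES; nothing here changes a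
label. Theorems only (no definition, no named fact, nothing asserted).

## What this file proves

For `E/ℚ` elliptic on `W`, `p` prime and a rational line `Φ₀ ≤ E[p]` (`IsRationalLine`), with
`(lineSub Φ₀ hΦ).Sub` / `.Quot` the transported line and its quotient (gen 16):

* `natCard_sub_eq`, `natCard_quot_eq` — both have order `p`;
* `exists_character_sub`, `exists_character_quot` — GV p. 28 "`G_ℚ` acts on `Φ` by a character `φ`
  … and on `Ψ` by a character `ψ`": there are PRIMITIVE Dirichlet characters `φ` mod `m`, `ψ` mod
  `d` with values in `𝔽_p` such that `σ • P = φ(χ_m(σ)) • P` on `Φ₀` and `σ • P ≡ ψ(χ_d(σ)) • P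
  (mod Φ₀)` on `E[p]` (Kronecker–Weber, `PrimeOrderCharacters`; the open kernel comes from the
  continuity of `ρ̄_{E,p}`, tree `isOpen_ker_galoisRepTorsion_holds`);
* `even_of_lineEven` (`φ` even), `odd_of_lineEven` (`ψ` odd; `p` odd; gen 16's
  `smul_add_self_mem_of_lineEven` and `χ_N(c) = −1`);
* `dvd_level_of_not_lineUnramifiedAt` (`p ∣ m`: `φ` ramified at `p`) and
  `not_dvd_level_of_not_lineUnramifiedAt` (`p ∤ d`: `ψ` unramified at `p`) — from the local line at
  one prime `𝔓 ∣ p` with inertially trivial quotient and an inertia element moving it (supplied by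
  the caller: the Tate line at `p ‖ N`, the reduction line at good ordinary `p`), which EQUALS the
  ramified rational line `Φ₀` (tree `eq_of_not_lineUnramifiedAt`); GV p. 26/28 "`Φ = C[p]`";
* `exists_mem_of_dvd_level_sub` / `_quot` — the primes `ℓ ≠ p` of `m` and the primes of `d` lie in any
  `Σ₀` outside which (away from `p`) `E` has good reduction (Silverman VII.4.1(a), tree
  `smul_geomTorsion_eq_of_mem_inertia`, + the conductor criterion).

References: [GreenbergVatsal2000] §2 pp. 26–28; [Washington1997] Ch. 3; [SilvermanAEC2009] VII.4.1.
-/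

set_option autoImplicit false

noncomputable section

open scoped Classical

open NumberField IsDedekindDomain Field Rat.HeightOneSpectrum WeierstrassCurve
  Literature.NumberTheory.GaloisRepresentations Literature.NumberTheory.EllipticCurves
  Literature.NumberTheory.EllipticCurves.Rank1Residual
  Summit.BirchSwinnertonDyer.Rank1Residual.X2.ResidualDevissageModules
  Summit.BirchSwinnertonDyer.Rank1Residual.X2.ResidualDevissageLine
  Summit.BirchSwinnertonDyer.Rank1Residual.X2.PrimeOrderCharacters

namespace Summit.BirchSwinnertonDyer.Rank1Residual.X2.ResidualLineCharacters

/-! ## §3. The characters `φ` of `Φ₀` and `ψ` of `E[p]/Φ₀` as primitive Dirichlet characters -/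

section Curve

variable {W : WeierstrassCurve ℚ} [W.IsElliptic] {p : ℕ} [hp : Fact p.Prime]
  {Φ₀ : AddSubgroup (geomTorsion W (p : ℤ))} (hΦ : IsRationalLine W p Φ₀)

include hΦ in
omit [W.IsElliptic] in
/-- `#Φ = p` for the transported line. -/
theorem natCard_sub_eq : Nat.card (lineSub Φ₀ hΦ).Sub = p := by
  change Nat.card ↥(Φ₀.map (torsionToPrimary W p)) = p
  rw [← Nat.card_congr (Φ₀.equivMapOfInjective (torsionToPrimary W p)
    (torsionToPrimary_bijective W p).1).toEquiv]
  exact hΦ.1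

include hΦ in
/-- `#(E[p]/Φ) = p`. -/
theorem natCard_quot_eq : Nat.card (lineSub Φ₀ hΦ).Quot = p := by
  have hpr : p.Prime := hp.out
  have hM := Nat.card_congr (Equiv.ofBijective _ (torsionToPrimary_bijective W p))
  rw [W.natCard_geomTorsion_eq_sq (Nat.cast_ne_zero.2 hpr.ne_zero)] at hM
  have h := (lineSub Φ₀ hΦ).natCard_eq_mul
  rw [← hM, natCard_sub_eq hΦ, pow_two] at h
  exact (Nat.eq_of_mul_eq_mul_right hpr.pos h).symm

omit [W.IsElliptic] in
/-- The action of `σ` on `Φ₀ ≤ E[p]` read on the transported line: if `σ` acts as `n` on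
`(lineSub Φ₀ hΦ).Sub` then `σ • P = n • P` for `P ∈ Φ₀`. -/
theorem smul_eq_nsmul_of_sub {σ : absoluteGaloisGroup ℚ} {n : ℕ}
    (h : ∀ x : (lineSub Φ₀ hΦ).Sub, σ • x = n • x) {P : geomTorsion W (p : ℤ)} (hP : P ∈ Φ₀) :
    σ • P = n • P := by
  have hx : torsionToPrimary W p P ∈ (lineSub Φ₀ hΦ).toAddSubgroup :=
    (torsionToPrimary_mem_lineSub_iff hΦ P).mpr hP
  have h1 := congrArg (lineSub Φ₀ hΦ).incl (h ⟨torsionToPrimary W p P, hx⟩)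
  rw [StableSubgroup.incl_smul, map_nsmul] at h1
  change σ • torsionToPrimary W p P = n • torsionToPrimary W p P at h1
  rw [← torsionToPrimary_smul, ← map_nsmul] at h1
  exact (torsionToPrimary_bijective W p).1 h1

omit [W.IsElliptic] in
/-- The action of `σ` on `E[p]/Φ₀` read on `E[p]`: if `σ` acts as `n` on `(lineSub Φ₀ hΦ).Quot`
then `σ • P − n • P ∈ Φ₀` for every `P ∈ E[p]`. -/
theorem smul_sub_nsmul_mem_of_quot {σ : absoluteGaloisGroup ℚ} {n : ℕ}
    (h : ∀ y : (lineSub Φ₀ hΦ).Quot, σ • y = n • y) (P : geomTorsion W (p : ℤ)) :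
    σ • P - n • P ∈ Φ₀ := by
  rw [← torsionToPrimary_mem_lineSub_iff hΦ, map_sub, map_nsmul, torsionToPrimary_smul,
    ← (lineSub Φ₀ hΦ).ker_proj, AddMonoidHom.mem_ker, map_sub, map_nsmul,
    StableSubgroup.proj_smul, h, sub_self]

omit [W.IsElliptic] in
/-- Conversely: if `σ • P − n • P ∈ Φ₀` for all `P ∈ E[p]` then `σ` acts as `n` on the quotient. -/
theorem smul_quot_eq_of_forall_mem {σ : absoluteGaloisGroup ℚ} {n : ℕ}
    (h : ∀ P : geomTorsion W (p : ℤ), σ • P - n • P ∈ Φ₀) (y : (lineSub Φ₀ hΦ).Quot) :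
    σ • y = n • y := by
  obtain ⟨m, rfl⟩ := (lineSub Φ₀ hΦ).proj_surjective y
  obtain ⟨P, rfl⟩ := (torsionToPrimary_bijective W p).2 m
  rw [← sub_eq_zero, ← StableSubgroup.proj_smul, ← map_nsmul, ← map_sub, ← AddMonoidHom.mem_ker,
    (lineSub Φ₀ hΦ).ker_proj, ← torsionToPrimary_smul, ← map_nsmul, ← map_sub,
    torsionToPrimary_mem_lineSub_iff hΦ]
  exact h P

omit [W.IsElliptic] in
/-- If `σ` fixes `E[p]` pointwise it acts trivially on `Φ₀` and on `E[p]/Φ₀`. -/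
theorem smul_sub_eq_self_of_forall {σ : absoluteGaloisGroup ℚ}
    (h : ∀ P : geomTorsion W (p : ℤ), σ • P = P) (x : (lineSub Φ₀ hΦ).Sub) : σ • x = x := by
  apply (lineSub Φ₀ hΦ).incl_injective
  obtain ⟨P, hP⟩ := (torsionToPrimary_bijective W p).2 ((lineSub Φ₀ hΦ).incl x)
  rw [StableSubgroup.incl_smul, ← hP, ← torsionToPrimary_smul, h]

omit [W.IsElliptic] in
/-- If `σ` fixes `E[p]` pointwise it acts trivially on `E[p]/Φ₀`. -/
theorem smul_quot_eq_self_of_forall {σ : absoluteGaloisGroup ℚ}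
    (h : ∀ P : geomTorsion W (p : ℤ), σ • P = P) (y : (lineSub Φ₀ hΦ).Quot) : σ • y = y := by
  have h1 := smul_quot_eq_of_forall_mem hΦ (n := 1) (fun P ↦ by
    rw [h, one_nsmul, sub_self]; exact Φ₀.zero_mem) y
  rwa [one_nsmul] at h1

include hΦ in
/-- **The character `φ` of `Φ₀` as a primitive Dirichlet character** (GV p. 28: "`G_ℚ` acts on `Φ`
by a character `φ : G_ℚ → (ℤ/pℤ)ˣ`"; Kronecker–Weber): there are `m ≥ 1` and a primitive Dirichlet
character `φ` mod `m` with values in `𝔽_p` such that every `σ ∈ Γ_ℚ` acts on `Φ₀` (and on the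
transported line) as the scalar `φ(χ_m(σ))`. -/
theorem exists_character_sub :
    ∃ (m : ℕ) (_ : NeZero m) (φ : DirichletCharacter (ZMod p) m), φ.IsPrimitive ∧
      (∀ (σ : absoluteGaloisGroup ℚ) (x : (lineSub Φ₀ hΦ).Sub),
        σ • x = (φ ((modNCyclotomicCharacter ℚ m σ : (ZMod m)ˣ) : ZMod m)).val • x) ∧
      (∀ (σ : absoluteGaloisGroup ℚ), ∀ P ∈ Φ₀,
        σ • P = (φ ((modNCyclotomicCharacter ℚ m σ : (ZMod m)ˣ) : ZMod m)).val • P) := by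
  have hpr : p.Prime := hp.out
  obtain ⟨χ, hχ⟩ := exists_character_of_natCard_eq (G := absoluteGaloisGroup ℚ)
    (natCard_sub_eq hΦ)
  -- open kernel: it contains `ker ρ̄_{E,p}`
  have hker : IsOpen ((χ.ker : Subgroup (absoluteGaloisGroup ℚ)) : Set (absoluteGaloisGroup ℚ)) := by
    refine Subgroup.isOpen_mono (H₁ := (galoisRepTorsion W (p : ℤ)).ker) ?_
      (isOpen_ker_galoisRepTorsion_holds W (n := (p : ℤ)) (by exact_mod_cast hpr.ne_zero))
    intro σ hσ
    rw [MonoidHom.mem_ker] at hσ ⊢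
    refine character_eq_one_of_forall_smul_eq (natCard_sub_eq hΦ) hχ fun x ↦ ?_
    refine smul_sub_eq_self_of_forall hΦ (fun P ↦ ?_) x
    rw [← galoisRepTorsion_apply, hσ]
    rfl
  obtain ⟨m, hm, φ, hφ, hφχ⟩ := exists_isPrimitive_dirichletCharacter_of_isOpen_ker χ hker
  refine ⟨m, hm, φ, hφ, fun σ x ↦ by rw [hχ, hφχ], fun σ P hP ↦ ?_⟩
  exact smul_eq_nsmul_of_sub hΦ (fun x ↦ by rw [hχ, hφχ]) hP

include hΦ in
/-- **The character `ψ` of `Ψ = E[p]/Φ₀` as a primitive Dirichlet character** (GV p. 28: "and on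
`Ψ` by a character `ψ`"; Kronecker–Weber). -/
theorem exists_character_quot :
    ∃ (d : ℕ) (_ : NeZero d) (ψ : DirichletCharacter (ZMod p) d), ψ.IsPrimitive ∧
      (∀ (σ : absoluteGaloisGroup ℚ) (y : (lineSub Φ₀ hΦ).Quot),
        σ • y = (ψ ((modNCyclotomicCharacter ℚ d σ : (ZMod d)ˣ) : ZMod d)).val • y) ∧
      (∀ (σ : absoluteGaloisGroup ℚ) (P : geomTorsion W (p : ℤ)),
        σ • P - (ψ ((modNCyclotomicCharacter ℚ d σ : (ZMod d)ˣ) : ZMod d)).val • P ∈ Φ₀) := by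
  have hpr : p.Prime := hp.out
  obtain ⟨χ, hχ⟩ := exists_character_of_natCard_eq (G := absoluteGaloisGroup ℚ)
    (natCard_quot_eq hΦ)
  have hker : IsOpen ((χ.ker : Subgroup (absoluteGaloisGroup ℚ)) : Set (absoluteGaloisGroup ℚ)) := by
    refine Subgroup.isOpen_mono (H₁ := (galoisRepTorsion W (p : ℤ)).ker) ?_
      (isOpen_ker_galoisRepTorsion_holds W (n := (p : ℤ)) (by exact_mod_cast hpr.ne_zero))
    intro σ hσ
    rw [MonoidHom.mem_ker] at hσ ⊢
    refine character_eq_one_of_forall_smul_eq (natCard_quot_eq hΦ) hχ fun y ↦ ?_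
    refine smul_quot_eq_self_of_forall hΦ (fun P ↦ ?_) y
    rw [← galoisRepTorsion_apply, hσ]
    rfl
  obtain ⟨d, hd, ψ, hψ, hψχ⟩ := exists_isPrimitive_dirichletCharacter_of_isOpen_ker χ hker
  refine ⟨d, hd, ψ, hψ, fun σ y ↦ by rw [hχ, hψχ], fun σ P ↦ ?_⟩
  exact smul_sub_nsmul_mem_of_quot hΦ (fun y ↦ by rw [hχ, hψχ]) P

end Curve

/-! ## §4. Parity, ramification at `p`, and the primes of the conductors -/

section Parity

variable {W : WeierstrassCurve ℚ} [W.IsElliptic] {p : ℕ} [hp : Fact p.Prime]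
  {Φ₀ : AddSubgroup (geomTorsion W (p : ℤ))} (hΦ : IsRationalLine W p Φ₀)

omit [W.IsElliptic] in
/-- `σ` fixing `Φ₀` pointwise acts trivially on the transported line. -/
theorem smul_sub_eq_self_of_forall_mem {σ : absoluteGaloisGroup ℚ} (h : ∀ P ∈ Φ₀, σ • P = P)
    (x : (lineSub Φ₀ hΦ).Sub) : σ • x = x := by
  apply (lineSub Φ₀ hΦ).incl_injective
  obtain ⟨P, hP, hPx⟩ : (lineSub Φ₀ hΦ).incl x ∈ Φ₀.map (torsionToPrimary W p) := x.2
  rw [StableSubgroup.incl_smul, ← hPx, ← torsionToPrimary_smul, h P hP]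

include hΦ in
omit [W.IsElliptic] in
/-- **`φ` is even** when `Φ₀` is even (complex conjugation acts trivially on `Φ₀`, and
`χ_m(c) = −1`). GV p. 28: "`φ` is ramified and even". -/
theorem even_of_lineEven (heven : LineEven W p Φ₀) {m : ℕ} [NeZero m]
    {φ : DirichletCharacter (ZMod p) m}
    (hφ : ∀ (σ : absoluteGaloisGroup ℚ) (x : (lineSub Φ₀ hΦ).Sub),
      σ • x = (φ ((modNCyclotomicCharacter ℚ m σ : (ZMod m)ˣ) : ZMod m)).val • x) :
    φ.Even := by
  obtain ⟨c, hc⟩ := exists_isComplexConjugation (K := ℚ) (Rat.castHom ℝ)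
  have hχ : ∀ (σ : absoluteGaloisGroup ℚ) (x : (lineSub Φ₀ hΦ).Sub),
      σ • x = ((φ.toUnitHom.comp (modNCyclotomicCharacter ℚ m) σ : (ZMod p)ˣ) : ZMod p).val • x :=
    fun σ x ↦ by rw [coe_toUnitHom_comp, hφ]
  have h1 := character_eq_intCast_of_forall_smul_eq (natCard_sub_eq hΦ) hχ (σ := c) (a := 1)
    (fun x ↦ by rw [one_zsmul]; exact smul_sub_eq_self_of_forall_mem hΦ (heven c hc) x)
  rw [coe_toUnitHom_comp, modNCyclotomicCharacter_of_isComplexConjugation hc, Int.cast_one] at h1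
  exact h1

include hΦ in
/-- **`ψ` is odd** when `Φ₀` is even and `p` is odd (complex conjugation acts as `−1` on `E[p]/Φ₀`,
the cell's `smul_add_self_mem_of_lineEven`). GV p. 28: "`ψ` is unramified and odd". -/
theorem odd_of_lineEven (hp2 : p ≠ 2) (heven : LineEven W p Φ₀) {d : ℕ} [NeZero d]
    {ψ : DirichletCharacter (ZMod p) d}
    (hψ : ∀ (σ : absoluteGaloisGroup ℚ) (y : (lineSub Φ₀ hΦ).Quot),
      σ • y = (ψ ((modNCyclotomicCharacter ℚ d σ : (ZMod d)ˣ) : ZMod d)).val • y) :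
    ψ.Odd := by
  have hpr : p.Prime := hp.out
  obtain ⟨c, hc⟩ := exists_isComplexConjugation (K := ℚ) (Rat.castHom ℝ)
  have hχ : ∀ (σ : absoluteGaloisGroup ℚ) (y : (lineSub Φ₀ hΦ).Quot),
      σ • y = ((ψ.toUnitHom.comp (modNCyclotomicCharacter ℚ d) σ : (ZMod p)ˣ) : ZMod p).val • y :=
    fun σ y ↦ by rw [coe_toUnitHom_comp, hψ]
  -- `c` acts as `p - 1` (i.e. `-1`) on `E[p]/Φ₀`
  have hc' : ∀ y : (lineSub Φ₀ hΦ).Quot, c • y = ((p - 1 : ℕ) : ℤ) • y := by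
    intro y
    rw [natCast_zsmul]
    refine smul_quot_eq_of_forall_mem hΦ (fun P ↦ ?_) y
    have hneg : (p - 1) • P = -P := by
      rw [eq_neg_iff_add_eq_zero, ← succ_nsmul, Nat.sub_add_cancel hpr.one_le]
      exact nsmul_eq_zero_of_mem_geomTorsion P
    rw [hneg, sub_neg_eq_add]
    exact smul_add_self_mem_of_lineEven hΦ hp2 heven hc P
  have h1 := character_eq_intCast_of_forall_smul_eq (natCard_quot_eq hΦ) hχ hc'
  rw [coe_toUnitHom_comp, modNCyclotomicCharacter_of_isComplexConjugation hc, Int.cast_natCast,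
    Nat.cast_sub hpr.one_le, CharP.cast_eq_zero, Nat.cast_one, zero_sub] at h1
  exact h1

end Parity

/-! ## §5. Ramification at `p` and the primes of the conductors -/

section Ramification

variable {W : WeierstrassCurve ℚ} [W.IsElliptic] {p : ℕ} [hp : Fact p.Prime]
  {Φ₀ : AddSubgroup (geomTorsion W (p : ℤ))} (hΦ : IsRationalLine W p Φ₀)

include hΦ in
omit [W.IsElliptic] in
/-- **`φ` is ramified at `p`: `p ∣ m`.** From the local line at a prime `𝔓 ∣ p` (Tate line at
`p ‖ N`, reduction line at good ordinary `p`: an inertia element moving a point of it) and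
`Φ₀ =` that line (`eq_of_not_lineUnramifiedAt`): if `p ∤ m` then `χ_m` is trivial on `I_𝔓`
(`modNCyclotomicCharacter_eq_one_of_mem_inertia`), a contradiction. GV p. 28: "`φ` is ramified". -/
theorem dvd_level_of_not_lineUnramifiedAt
    (hline : ∃ (v : HeightOneSpectrum (𝓞 ℚ)), (p : 𝓞 ℚ) ∈ v.asIdeal ∧ ∃ 𝔓 ∈ v.primesAbove,
      ∃ L : AddSubgroup (geomTorsion W (p : ℤ)), Nat.card L = p ∧
        (∀ σ ∈ 𝔓.inertia (absoluteGaloisGroup ℚ), ∀ P : geomTorsion W (p : ℤ), σ • P - P ∈ L) ∧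
        (∃ σ ∈ 𝔓.inertia (absoluteGaloisGroup ℚ), ∃ P ∈ L, σ • P ≠ P))
    (hram : ¬ LineUnramifiedAt W p Φ₀) {m : ℕ} [NeZero m] {φ : DirichletCharacter (ZMod p) m}
    (hφ0 : ∀ (σ : absoluteGaloisGroup ℚ), ∀ P ∈ Φ₀,
      σ • P = (φ ((modNCyclotomicCharacter ℚ m σ : (ZMod m)ˣ) : ZMod m)).val • P) :
    p ∣ m := by
  have hpr : p.Prime := hp.out
  obtain ⟨v, hv, 𝔓, h𝔓, L, hLcard, hLsub, σ, hσI, P, hPL, hne⟩ := hline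
  have hΦL : Φ₀ = L := eq_of_not_lineUnramifiedAt hΦ hram hv h𝔓 hLcard hLsub
  by_contra hpm
  apply hne
  have hpv : ((primesEquiv v : Nat.Primes) : ℕ) = p := natGenerator_eq_of_natCast_mem_asIdeal hpr hv
  have hN : (m : absIntegers (𝓞 ℚ) ℚ) ∉ 𝔓 :=
    Rat.natCast_not_mem_of_mem_primesAbove_of_not_dvd h𝔓 (by rw [hpv]; exact hpm)
  haveI := h𝔓.1
  have h1 : modNCyclotomicCharacter ℚ m σ = 1 := modNCyclotomicCharacter_eq_one_of_mem_inertia hN hσI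
  have h2 := hφ0 σ P (hΦL ▸ hPL)
  rw [h1, Units.val_one, map_one, ZMod.val_one'' hpr.ne_one, one_nsmul] at h2
  exact h2

include hΦ in
/-- **`ψ` is unramified at `p`: `p ∤ d`.** The local line `C[p] = Φ₀` at `𝔓 ∣ p` has an
`I_𝔓`-trivial quotient (GV p. 26 / p. 28: "`Φ = C[p]`", "`ψ` is unramified"), so `ψ(χ_d(τ)) = 1` on
`I_𝔓` and the conductor of the primitive `ψ` is prime to `p`. -/
theorem not_dvd_level_of_not_lineUnramifiedAt
    (hline : ∃ (v : HeightOneSpectrum (𝓞 ℚ)), (p : 𝓞 ℚ) ∈ v.asIdeal ∧ ∃ 𝔓 ∈ v.primesAbove,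
      ∃ L : AddSubgroup (geomTorsion W (p : ℤ)), Nat.card L = p ∧
        (∀ σ ∈ 𝔓.inertia (absoluteGaloisGroup ℚ), ∀ P : geomTorsion W (p : ℤ), σ • P - P ∈ L) ∧
        (∃ σ ∈ 𝔓.inertia (absoluteGaloisGroup ℚ), ∃ P ∈ L, σ • P ≠ P))
    (hram : ¬ LineUnramifiedAt W p Φ₀) {d : ℕ} [NeZero d] {ψ : DirichletCharacter (ZMod p) d}
    (hψprim : ψ.IsPrimitive)
    (hψ : ∀ (σ : absoluteGaloisGroup ℚ) (y : (lineSub Φ₀ hΦ).Quot),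
      σ • y = (ψ ((modNCyclotomicCharacter ℚ d σ : (ZMod d)ˣ) : ZMod d)).val • y) :
    ¬ p ∣ d := by
  have hpr : p.Prime := hp.out
  obtain ⟨v, hv, 𝔓, h𝔓, L, hLcard, hLsub, -⟩ := hline
  have hΦL : Φ₀ = L := eq_of_not_lineUnramifiedAt hΦ hram hv h𝔓 hLcard hLsub
  have hχ : ∀ (σ : absoluteGaloisGroup ℚ) (y : (lineSub Φ₀ hΦ).Quot),
      σ • y = ((ψ.toUnitHom.comp (modNCyclotomicCharacter ℚ d) σ : (ZMod p)ˣ) : ZMod p).val • y :=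
    fun σ y ↦ by rw [coe_toUnitHom_comp, hψ]
  refine not_dvd_level_of_isPrimitive_of_forall_mem_inertia hψprim hpr hv h𝔓 fun τ hτ ↦ ?_
  have h1 := character_eq_intCast_of_forall_smul_eq (natCard_quot_eq hΦ) hχ (σ := τ) (a := 1)
    (fun y ↦ by
      rw [one_zsmul]
      have h := smul_quot_eq_of_forall_mem hΦ (n := 1) (fun P ↦ by
        rw [one_nsmul, hΦL]; exact hLsub τ hτ P) y
      rwa [one_nsmul] at h)
  rw [coe_toUnitHom_comp, Int.cast_one] at h1
  exact h1

include hΦ in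
/-- **The primes `ℓ ≠ p` of the conductor of `φ` lie in `Σ₀`** (Néron–Ogg–Shafarevich: at a good
place `v ∉ Σ₀`, `v ∤ p`, inertia acts trivially on `E[p]`, hence on `Φ₀`, so `ℓ ∤ m` by the
conductor criterion). -/
theorem exists_mem_of_dvd_level_sub {S₀ : Finset (HeightOneSpectrum (𝓞 ℚ))}
    (hS : ∀ v : HeightOneSpectrum (𝓞 ℚ), v ∉ S₀ → ((p : ℕ) : 𝓞 ℚ) ∉ v.asIdeal →
      W.HasGoodReductionAt v)
    {m : ℕ} [NeZero m] {φ : DirichletCharacter (ZMod p) m} (hφprim : φ.IsPrimitive)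
    (hφ : ∀ (σ : absoluteGaloisGroup ℚ) (x : (lineSub Φ₀ hΦ).Sub),
      σ • x = (φ ((modNCyclotomicCharacter ℚ m σ : (ZMod m)ˣ) : ZMod m)).val • x)
    {ℓ : ℕ} (hℓ : ℓ.Prime) (hℓm : ℓ ∣ m) (hℓp : ℓ ≠ p) :
    ∃ v ∈ S₀, ((ℓ : ℕ) : 𝓞 ℚ) ∈ v.asIdeal := by
  have hpr : p.Prime := hp.out
  obtain ⟨v, hv⟩ :=
    Literature.NumberTheory.NumberFields.RingOfIntegers.exists_heightOneSpectrum_natCast_mem ℚ hℓ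
  by_cases hvS : v ∈ S₀
  · exact ⟨v, hvS, hv⟩
  exfalso
  have hpv : ((p : ℕ) : 𝓞 ℚ) ∉ v.asIdeal := fun h ↦ hℓp <| by
    rw [← natGenerator_eq_of_natCast_mem_asIdeal hℓ hv, natGenerator_eq_of_natCast_mem_asIdeal hpr h]
  have hgood := hS v hvS hpv
  have hχ : ∀ (σ : absoluteGaloisGroup ℚ) (x : (lineSub Φ₀ hΦ).Sub),
      σ • x = ((φ.toUnitHom.comp (modNCyclotomicCharacter ℚ m) σ : (ZMod p)ˣ) : ZMod p).val • x :=
    fun σ x ↦ by rw [coe_toUnitHom_comp, hφ]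
  refine not_dvd_level_of_isPrimitive_of_forall_mem_inertia hφprim hℓ hv
    (adicCompletionPrime_mem_primesAbove ℚ v) (fun τ hτ ↦ ?_) hℓm
  have hfix : ∀ P : geomTorsion W (p : ℤ), τ • P = P := fun P ↦
    W.smul_geomTorsion_eq_of_mem_inertia hgood (n := (p : ℤ)) (by rw [Int.cast_natCast]; exact hpv)
      (adicCompletionPrime_mem_primesAbove ℚ v) hτ P
  have h1 := character_eq_intCast_of_forall_smul_eq (natCard_sub_eq hΦ) hχ (σ := τ) (a := 1)
    (fun x ↦ by rw [one_zsmul]; exact smul_sub_eq_self_of_forall hΦ hfix x)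
  rw [coe_toUnitHom_comp, Int.cast_one] at h1
  exact h1

include hΦ in
/-- **The primes of the conductor of `ψ` lie in `Σ₀`** (as above, on the quotient `E[p]/Φ₀`). -/
theorem exists_mem_of_dvd_level_quot {S₀ : Finset (HeightOneSpectrum (𝓞 ℚ))}
    (hS : ∀ v : HeightOneSpectrum (𝓞 ℚ), v ∉ S₀ → ((p : ℕ) : 𝓞 ℚ) ∉ v.asIdeal →
      W.HasGoodReductionAt v)
    {d : ℕ} [NeZero d] {ψ : DirichletCharacter (ZMod p) d} (hψprim : ψ.IsPrimitive) (hpd : ¬ p ∣ d)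
    (hψ : ∀ (σ : absoluteGaloisGroup ℚ) (y : (lineSub Φ₀ hΦ).Quot),
      σ • y = (ψ ((modNCyclotomicCharacter ℚ d σ : (ZMod d)ˣ) : ZMod d)).val • y)
    {ℓ : ℕ} (hℓ : ℓ.Prime) (hℓd : ℓ ∣ d) :
    ∃ v ∈ S₀, ((ℓ : ℕ) : 𝓞 ℚ) ∈ v.asIdeal := by
  have hpr : p.Prime := hp.out
  have hℓp : ℓ ≠ p := by rintro rfl; exact hpd hℓd
  obtain ⟨v, hv⟩ :=
    Literature.NumberTheory.NumberFields.RingOfIntegers.exists_heightOneSpectrum_natCast_mem ℚ hℓ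
  by_cases hvS : v ∈ S₀
  · exact ⟨v, hvS, hv⟩
  exfalso
  have hpv : ((p : ℕ) : 𝓞 ℚ) ∉ v.asIdeal := fun h ↦ hℓp <| by
    rw [← natGenerator_eq_of_natCast_mem_asIdeal hℓ hv, natGenerator_eq_of_natCast_mem_asIdeal hpr h]
  have hgood := hS v hvS hpv
  have hχ : ∀ (σ : absoluteGaloisGroup ℚ) (y : (lineSub Φ₀ hΦ).Quot),
      σ • y = ((ψ.toUnitHom.comp (modNCyclotomicCharacter ℚ d) σ : (ZMod p)ˣ) : ZMod p).val • y :=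
    fun σ y ↦ by rw [coe_toUnitHom_comp, hψ]
  refine not_dvd_level_of_isPrimitive_of_forall_mem_inertia hψprim hℓ hv
    (adicCompletionPrime_mem_primesAbove ℚ v) (fun τ hτ ↦ ?_) hℓd
  have hfix : ∀ P : geomTorsion W (p : ℤ), τ • P = P := fun P ↦
    W.smul_geomTorsion_eq_of_mem_inertia hgood (n := (p : ℤ)) (by rw [Int.cast_natCast]; exact hpv)
      (adicCompletionPrime_mem_primesAbove ℚ v) hτ P
  have h1 := character_eq_intCast_of_forall_smul_eq (natCard_quot_eq hΦ) hχ (σ := τ) (a := 1)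
    (fun y ↦ by rw [one_zsmul]; exact smul_quot_eq_self_of_forall hΦ hfix y)
  rw [coe_toUnitHom_comp, Int.cast_one] at h1
  exact h1

end Ramification

end Summit.BirchSwinnertonDyer.Rank1Residual.X2.ResidualLineCharacters

end
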